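import Mathlib
import HarnessLib
import Literature.Analysis.FluidPDE.HardSphereFlowJointMeasurable
import Summits.AtomisticToContinuum.HydrodynamicLimit.Theorems.MourreKoopmanChargesOneBodyCompletenessTorusStatics

/-!
# `OneBodyCompleteness` · line `torus_fejer` (v2), stub `stub_windowToCesaroAll`:
# all-window variance decay of the one-body field implies Cesàro decay of its two-time correlation

Support file for the crux item stmt-AtomisticToContinuum-9583 (`OneBodyCompleteness`, route
`MourreKoopmanCharges` of `AtomisticToContinuum/HydrodynamicLimit`), proving the registered stub
`stub_windowToCesaroAll` of the skeleton `Cruxes/OneBodyCompleteness/Lines/torus_fejer.lean`.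

Setting: `N + 1` hard spheres of diameter `hsDiameter σ N` on `𝕋³` under the canonical law
`G = localGibbsLaw σ 1 0 θ N (Φ N)` (`0 < σ < 1/2`, `0 < θ`), a continuous polynomially bounded
velocity profile `h` with `∫ h M_θ = 0`, a continuous `χ` on `𝕋³`, the one-body empirical field
`A(z) = ∫ χ(y.1) h(y.2) d(empiricalMeasure z)` and the kinetic time scale `c = (N+1)^{-1/3}`.

Claim (finite `N`, exact): if the window variance `E_G[(S⁻¹ ∫₀^S A(Φ_{sc} z) ds)²]` is
`≤ δ'/(N+1)` at all large windows `S` (for `N ≥ N₀(S)`), then the Cesàro means of the rescaled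
two-time correlation `c_N(s) = (N+1) E_G[A(Φ_{sc} z) A(z)]` are eventually `≤ δ` in absolute value.

Proof.
* FUBINI: `S⁻¹ ∫₀^S c_N(s) ds = (N+1) E_G[X · A]` with the window average
  `X(z) = S⁻¹ ∫₀^S A(Φ_{sc} z) ds`; the integrand `A(Φ_{sc} z) A(z)` is integrable on
  `[0, S] × G` since the flow is jointly a.e.-measurable on the good set
  (`HardSphereFlow.measurable_flow_prod_torus`), `|xy| ≤ x² + y²`, Tonelli, invariance of `G`
  under every `Φ_t` and `A ∈ L²(G)`.
* `2|xy| ≤ λ x² + y²/λ`: `|(N+1) E[X A]| ≤ (λ/2)(N+1)E[X²] + (N+1)E[A²]/(2λ)`, where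
  `(N+1) E[A²] = M := (∫ χ²)(∫ h² M_θ)` exactly (`torusStaticVariance`) and `(N+1) E[X²] ≤ δ'` by
  hypothesis; with `λ = (|M|+1)/δ` and `δ' = δ²/(|M|+1)` the bound is `≤ δ/2 + δ/2`.

References: H. Spohn, *Large Scale Dynamics of Interacting Particles* (1991), Part II §7.1
(Fejér vs Cesàro means of current correlations). Folklore otherwise.
-/

noncomputable section

namespace Summit.AtomisticToContinuum.HydrodynamicLimit.Theorems.MourreKoopmanChargesOneBodyCompleteness

open MeasureTheory ProbabilityTheory Filter Topology Set
open scoped ENNReal BigOperators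
open Literature.Analysis.FluidPDE Literature.MathematicalPhysics.KineticTheory
open UnitAddTorus

namespace stub_windowToCesaroAllAux

/-! ### Two real-variable inequalities -/

/-- The weighted arithmetic–geometric mean inequality `|x y| ≤ (λ/2) x² + y²/(2λ)` (`λ > 0`).
[folklore] -/
theorem abs_mul_le_weighted {lam : ℝ} (hlam : 0 < lam) (x y : ℝ) :
    |x * y| ≤ lam / 2 * x ^ 2 + 1 / (2 * lam) * y ^ 2 := by
  have e : lam / 2 * x ^ 2 + 1 / (2 * lam) * y ^ 2 =
      ((lam * |x|) ^ 2 + |y| ^ 2) / (2 * lam) := by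
    rw [mul_pow, sq_abs, sq_abs]
    field_simp
  rw [abs_mul, e, le_div_iff₀ (by positivity)]
  nlinarith [sq_nonneg (lam * |x| - |y|)]

/-- `‖x y‖ₑ ≤ ofReal (x²) + ofReal (y²)` (the `ℝ≥0∞` form of `|x y| ≤ x² + y²`). [folklore] -/
theorem enorm_mul_le (x y : ℝ) :
    ‖x * y‖ₑ ≤ ENNReal.ofReal (x ^ 2) + ENNReal.ofReal (y ^ 2) := by
  rw [Real.enorm_eq_ofReal_abs, ← ENNReal.ofReal_add (sq_nonneg _) (sq_nonneg _)]
  refine ENNReal.ofReal_le_ofReal ?_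
  rw [abs_mul, ← sq_abs x, ← sq_abs y]
  nlinarith [sq_nonneg (|x| - |y|), abs_nonneg x, abs_nonneg y, mul_nonneg (abs_nonneg x)
    (abs_nonneg y)]

/-! ### The time-rescaled flow on `[0, S] × (phase space)` -/

variable {n : ℕ} {ε : ℝ}

/-- Joint a.e.-measurability of the time-rescaled flow `(s, z) ↦ Φ_{s c} z` on `ν ⊗ μ` for every
s-finite `ν` on `ℝ` and every s-finite `μ` on phase space carried by the good set (the flow is
measurable on `good × ℝ`, `HardSphereFlow.measurable_flow_prod_torus`; modify it off the good set).
[folklore] -/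
theorem aemeasurable_flow_mul_prod (Φ : HardSphereFlow (Torus.geometry (Fin 3)) ε n) (c : ℝ)
    (ν : Measure ℝ) [SFinite ν] (μ : Measure (Config n (Fin 3) T3)) [SFinite μ]
    (hμ : μ Φ.goodᶜ = 0) :
    AEMeasurable (fun p : ℝ × Config n (Fin 3) T3 => Φ.flow (p.1 * c) p.2) (ν.prod μ) := by
  -- adapted from AntiMazurCoboundariesVarianceCertificate.aemeasurable_flow_prod
  classical
  set s : Set (ℝ × Config n (Fin 3) T3) := Prod.snd ⁻¹' Φ.good with hs_def
  have hs : MeasurableSet s := measurable_snd Φ.measurableSet_good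
  have hf : Measurable fun q : s =>
      Φ.flow ((q : ℝ × Config n (Fin 3) T3).1 * c)
        (((⟨(q : ℝ × Config n (Fin 3) T3).2, q.2⟩ : Φ.good)) : Config n (Fin 3) T3) := by
    have h1 : Measurable fun q : s =>
        (((⟨(q : ℝ × Config n (Fin 3) T3).2, q.2⟩ : Φ.good)),
          (q : ℝ × Config n (Fin 3) T3).1 * c) :=
      ((measurable_snd.comp measurable_subtype_coe).subtype_mk).prodMk
        ((measurable_fst.comp measurable_subtype_coe).mul_const c)
    exact Φ.measurable_flow_prod_torus.comp h1
  refine ⟨fun p => if hp : p ∈ s then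
      Φ.flow (p.1 * c) (((⟨p.2, hp⟩ : Φ.good)) : Config n (Fin 3) T3) else p.2, ?_, ?_⟩
  · exact Measurable.dite hf (measurable_snd.comp measurable_subtype_coe) hs
  · have hae : ∀ᵐ z ∂μ, z ∈ Φ.good := mem_ae_iff.2 hμ
    have hae' : ∀ᵐ p ∂(ν.prod μ), p.2 ∈ Φ.good :=
      (Measure.quasiMeasurePreserving_snd (μ := ν) (ν := μ)).ae hae
    filter_upwards [hae'] with p hp
    have hp' : p ∈ s := hp
    simp only [hp', dif_pos]

/-- The window integral `z ↦ ∫_{(0,S]} A(Φ_{sc} z) ds` of a measurable observable along the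
time-rescaled flow is a.e.-strongly measurable for every s-finite law carried by the good set
(Fubini measurability after `aemeasurable_flow_mul_prod`). [folklore] -/
theorem aestronglyMeasurable_window (Φ : HardSphereFlow (Torus.geometry (Fin 3)) ε n)
    (μ : Measure (Config n (Fin 3) T3)) [SFinite μ] (hμ : μ Φ.goodᶜ = 0)
    {A : Config n (Fin 3) T3 → ℝ} (hA : Measurable A) (c S : ℝ) :
    AEStronglyMeasurable (fun z => ∫ s in Ioc 0 S, A (Φ.flow (s * c) z)) μ := by
  have h1 : AEStronglyMeasurable (fun p : ℝ × Config n (Fin 3) T3 => A (Φ.flow (p.1 * c) p.2))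
      ((volume.restrict (Ioc 0 S)).prod μ) :=
    (hA.comp_aemeasurable (aemeasurable_flow_mul_prod Φ c _ μ hμ)).aestronglyMeasurable
  exact h1.prod_swap.integral_prod_right'

/-- **Fubini for the two-time correlation.** For a finite law `μ` carried by the good set and
invariant under every `Φ_t`, and a measurable `A ∈ L²(μ)`:
`∫₀^S (∫ A(Φ_{sc} z) A(z) dμ) ds = ∫ (∫₀^S A(Φ_{sc} z) ds) A(z) dμ` (`0 ≤ S`); the integrand is
integrable on `[0, S] × μ` by `|xy| ≤ x² + y²`, Tonelli and invariance. [folklore] -/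
theorem integral_integral_flow_mul_swap (Φ : HardSphereFlow (Torus.geometry (Fin 3)) ε n)
    (μ : Measure (Config n (Fin 3) T3)) [IsFiniteMeasure μ]
    (hinv : ∀ t, MeasurePreserving (Φ.flow t) μ μ) (hμ : μ Φ.goodᶜ = 0)
    {A : Config n (Fin 3) T3 → ℝ} (hA : Measurable A) (hA2 : MemLp A 2 μ) (c : ℝ) {S : ℝ}
    (hS : 0 ≤ S) :
    ∫ s in (0 : ℝ)..S, ∫ z, A (Φ.flow (s * c) z) * A z ∂μ =
      ∫ z, (∫ s in (0 : ℝ)..S, A (Φ.flow (s * c) z)) * A z ∂μ := by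
  simp_rw [intervalIntegral.integral_of_le hS]
  set ν : Measure ℝ := volume.restrict (Ioc 0 S) with hν
  have hflow := aemeasurable_flow_mul_prod Φ c ν μ hμ
  have h2 : ∫⁻ z, ENNReal.ofReal (A z ^ 2) ∂μ < ∞ :=
    (hasFiniteIntegral_iff_ofReal (ae_of_all _ fun z => sq_nonneg (A z))).1
      hA2.integrable_sq.hasFiniteIntegral
  have hF1 : AEMeasurable (fun p : ℝ × Config n (Fin 3) T3 =>
      ENNReal.ofReal (A (Φ.flow (p.1 * c) p.2) ^ 2)) (ν.prod μ) :=
    ((hA.comp_aemeasurable hflow).pow_const 2).ennreal_ofReal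
  have hslice : ∀ s : ℝ, ∫⁻ z, ENNReal.ofReal (A (Φ.flow (s * c) z) ^ 2) ∂μ =
      ∫⁻ z, ENNReal.ofReal (A z ^ 2) ∂μ :=
    fun s => (hinv (s * c)).lintegral_comp (hA.pow_const 2).ennreal_ofReal
  have hI1 : ∫⁻ p, ENNReal.ofReal (A (Φ.flow (p.1 * c) p.2) ^ 2) ∂(ν.prod μ) =
      (∫⁻ z, ENNReal.ofReal (A z ^ 2) ∂μ) * ν univ := by
    rw [lintegral_prod _ hF1]
    simp only [hslice, lintegral_const]
  have hI2 : ∫⁻ p, ENNReal.ofReal (A p.2 ^ 2) ∂(ν.prod μ) =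
      (∫⁻ z, ENNReal.ofReal (A z ^ 2) ∂μ) * ν univ := by
    have hF2 : AEMeasurable (fun p : ℝ × Config n (Fin 3) T3 => ENNReal.ofReal (A p.2 ^ 2))
        (ν.prod μ) :=
      ((hA.comp measurable_snd).pow_const 2).ennreal_ofReal.aemeasurable
    rw [lintegral_prod _ hF2]
    simp only [lintegral_const]
  have hνfin : ν univ < ∞ := measure_lt_top ν _
  have hInt : Integrable (Function.uncurry fun (s : ℝ) (z : Config n (Fin 3) T3) =>
      A (Φ.flow (s * c) z) * A z) (ν.prod μ) := by
    refine ⟨((hA.comp_aemeasurable hflow).mul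
      (hA.comp measurable_snd).aemeasurable).aestronglyMeasurable, ?_⟩
    show ∫⁻ p, ‖A (Φ.flow (p.1 * c) p.2) * A p.2‖ₑ ∂(ν.prod μ) < ∞
    calc ∫⁻ p, ‖A (Φ.flow (p.1 * c) p.2) * A p.2‖ₑ ∂(ν.prod μ)
        ≤ ∫⁻ p, (ENNReal.ofReal (A (Φ.flow (p.1 * c) p.2) ^ 2) + ENNReal.ofReal (A p.2 ^ 2))
            ∂(ν.prod μ) := lintegral_mono fun p => enorm_mul_le _ _
      _ = (∫⁻ z, ENNReal.ofReal (A z ^ 2) ∂μ) * ν univ +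
            (∫⁻ z, ENNReal.ofReal (A z ^ 2) ∂μ) * ν univ := by
          rw [lintegral_add_left' hF1, hI1, hI2]
      _ < ∞ := ENNReal.add_lt_top.2
          ⟨ENNReal.mul_lt_top h2 hνfin, ENNReal.mul_lt_top h2 hνfin⟩
  rw [integral_integral_swap hInt]
  refine integral_congr_ae (ae_of_all _ fun z => ?_)
  exact integral_mul_const (A z) _

/-- **The Cesàro bound behind `stub_windowToCesaroAll`.** For a finite law `μ` carried by the
good set and invariant under every `Φ_t`, a measurable `A ∈ L²(μ)` with `K · ∫ A² dμ = M`
(`K > 0`), a window `S > 0` and a tolerance `δ > 0`: if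
`∫⁻ ofReal ((S⁻¹ ∫₀^S A(Φ_{sc} z) ds)²) dμ ≤ ofReal ((δ²/(|M|+1)) / K)`, then
`|S⁻¹ ∫₀^S K · (∫ A(Φ_{sc} z) A(z) dμ) ds| ≤ δ` (Fubini, `2|xy| ≤ λx² + y²/λ` with
`λ = (|M|+1)/δ`). [folklore] -/
theorem abs_cesaro_le (Φ : HardSphereFlow (Torus.geometry (Fin 3)) ε n)
    (μ : Measure (Config n (Fin 3) T3)) [IsFiniteMeasure μ]
    (hinv : ∀ t, MeasurePreserving (Φ.flow t) μ μ) (hμ : μ Φ.goodᶜ = 0)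
    {A : Config n (Fin 3) T3 → ℝ} (hA : Measurable A) (hA2 : MemLp A 2 μ) (c : ℝ) {K M δ S : ℝ}
    (hK : 0 < K) (hδ : 0 < δ) (hS : 0 < S) (hstat : K * ∫ z, A z ^ 2 ∂μ = M)
    (hlin : ∫⁻ z, ENNReal.ofReal ((S⁻¹ * ∫ s in (0 : ℝ)..S, A (Φ.flow (s * c) z)) ^ 2) ∂μ ≤
      ENNReal.ofReal (δ ^ 2 / (|M| + 1) / K)) :
    |S⁻¹ * ∫ s in (0 : ℝ)..S, K * ∫ z, A (Φ.flow (s * c) z) * A z ∂μ| ≤ δ := by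
  set X : Config n (Fin 3) T3 → ℝ := fun z => S⁻¹ * ∫ s in (0 : ℝ)..S, A (Φ.flow (s * c) z)
    with hX
  set lam : ℝ := (|M| + 1) / δ with hlam
  have hM1 : 0 < |M| + 1 := by positivity
  have hlam0 : 0 < lam := by positivity
  -- measurability and square integrability of the window average `X`
  have hXm : AEStronglyMeasurable X μ := by
    refine ((aestronglyMeasurable_window Φ μ hμ hA c S).const_mul S⁻¹).congr
      (ae_of_all _ fun z => ?_)
    simp only [hX, intervalIntegral.integral_of_le hS.le]
  have hX2m : AEStronglyMeasurable (fun z => X z ^ 2) μ :=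
    (hXm.aemeasurable.pow_const 2).aestronglyMeasurable
  have hfin : ∫⁻ z, ENNReal.ofReal (X z ^ 2) ∂μ < ∞ :=
    lt_of_le_of_lt hlin ENNReal.ofReal_lt_top
  have hX2i : Integrable (fun z => X z ^ 2) μ :=
    ⟨hX2m, (hasFiniteIntegral_iff_ofReal (ae_of_all _ fun z => sq_nonneg (X z))).2 hfin⟩
  have hX2le : K * ∫ z, X z ^ 2 ∂μ ≤ δ ^ 2 / (|M| + 1) := by
    rw [integral_eq_lintegral_of_nonneg_ae (ae_of_all _ fun z => sq_nonneg (X z)) hX2m,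
      ← le_div_iff₀' hK]
    have h := ENNReal.toReal_mono ENNReal.ofReal_ne_top hlin
    rwa [ENNReal.toReal_ofReal (by positivity)] at h
  have hA2i : Integrable (fun z => A z ^ 2) μ := hA2.integrable_sq
  -- Fubini
  have hF : S⁻¹ * ∫ s in (0 : ℝ)..S, K * ∫ z, A (Φ.flow (s * c) z) * A z ∂μ =
      K * ∫ z, X z * A z ∂μ := by
    rw [intervalIntegral.integral_const_mul, mul_left_comm,
      integral_integral_flow_mul_swap Φ μ hinv hμ hA hA2 c hS.le, ← integral_const_mul S⁻¹]
    congr 1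
    refine integral_congr_ae (ae_of_all _ fun z => ?_)
    simp only [hX, mul_assoc]
  rw [hF, abs_mul, abs_of_pos hK]
  -- the weighted AM–GM bound, integrated
  have hXA : |∫ z, X z * A z ∂μ| ≤ lam / 2 * ∫ z, X z ^ 2 ∂μ + 1 / (2 * lam) * ∫ z, A z ^ 2 ∂μ := by
    calc |∫ z, X z * A z ∂μ| ≤ ∫ z, |X z * A z| ∂μ := abs_integral_le_integral_abs
      _ ≤ ∫ z, (lam / 2 * X z ^ 2 + 1 / (2 * lam) * A z ^ 2) ∂μ :=
          integral_mono_of_nonneg (ae_of_all _ fun z => abs_nonneg _)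
            ((hX2i.const_mul _).add (hA2i.const_mul _))
            (ae_of_all _ fun z => abs_mul_le_weighted hlam0 (X z) (A z))
      _ = lam / 2 * ∫ z, X z ^ 2 ∂μ + 1 / (2 * lam) * ∫ z, A z ^ 2 ∂μ := by
          rw [integral_add (hX2i.const_mul _) (hA2i.const_mul _), integral_const_mul,
            integral_const_mul]
  have e1 : lam / 2 * (δ ^ 2 / (|M| + 1)) = δ / 2 := by
    simp only [hlam]
    field_simp
  have e2 : 1 / (2 * lam) * M ≤ δ / 2 := by
    have e3 : 1 / (2 * lam) * M = δ / 2 * (M / (|M| + 1)) := by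
      simp only [hlam]
      field_simp
    rw [e3]
    refine mul_le_of_le_one_right (by positivity) ((div_le_one hM1).2 ?_)
    linarith [le_abs_self M]
  calc K * |∫ z, X z * A z ∂μ|
      ≤ K * (lam / 2 * ∫ z, X z ^ 2 ∂μ + 1 / (2 * lam) * ∫ z, A z ^ 2 ∂μ) :=
        mul_le_mul_of_nonneg_left hXA hK.le
    _ = lam / 2 * (K * ∫ z, X z ^ 2 ∂μ) + 1 / (2 * lam) * (K * ∫ z, A z ^ 2 ∂μ) := by ring
    _ ≤ lam / 2 * (δ ^ 2 / (|M| + 1)) + 1 / (2 * lam) * M := by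
        rw [hstat]
        gcongr
    _ ≤ δ := by rw [e1]; linarith

end stub_windowToCesaroAllAux

open stub_windowToCesaroAllAux in
/-- **STUB S1 `stub_windowToCesaroAll`** of the line `torus_fejer` (v2) of crux
stmt-AtomisticToContinuum-9583 (`OneBodyCompleteness`): for `0 < σ < 1/2`, `θ > 0`, a continuous
polynomially bounded mean-zero profile `h`, a flow family `Φ` and a continuous `χ`, if the window
variance of the one-body field `A = A_h(χ)` under the canonical law decays at all large windows
(`∀ δ ∃ T₀ ∀ T ≥ T₀ ∃ N₀ ∀ N ≥ N₀, (N+1) E_G[(T⁻¹∫₀ᵀ A∘Φ_{s(N+1)^{-1/3}} ds)²] ≤ δ`), then the Cesàro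
means of the rescaled two-time correlation `c_N(s) = (N+1) E_G[A(Φ_{s(N+1)^{-1/3}} z) A(z)]` are
eventually `≤ δ`: Fubini (`S⁻¹∫₀^S c_N = (N+1) E_G[avg_S(A∘Φ)·A]`), `2|xy| ≤ λx² + y²/λ` with
`λ = (M+1)/δ`, `M = (∫χ²)(∫h²M_θ) = (N+1)E_G[A²]` (`torusStaticVariance`), tolerance `δ²/(M+1)`.
[folklore] -/
theorem stub_windowToCesaroAll :
    ∀ σ : ℝ, 0 < σ → σ < 1 / 2 → ∀ θ : ℝ, 0 < θ →
      ∀ h : V3 → ℝ, Continuous h → (∃ (C : ℝ) (k : ℕ), ∀ v, |h v| ≤ C * (1 + ‖v‖) ^ k) →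
        (∫ v, h v * localMaxwellian 1 θ (0 : V3) v = 0) →
        ∀ (Φ : (N : ℕ) → HardSphereFlow (Torus.geometry (Fin 3)) (hsDiameter σ N) (N + 1))
          (χ : T3 → ℝ), Continuous χ →
          (∀ δ : ℝ, 0 < δ → ∃ T₀ : ℝ, 0 < T₀ ∧ ∀ T : ℝ, T₀ ≤ T → ∃ N₀ : ℕ, ∀ N : ℕ, N₀ ≤ N →
            ∫⁻ z, ENNReal.ofReal ((T⁻¹ * ∫ s in (0 : ℝ)..T,
                ∫ y, χ y.1 * h y.2
                  ∂(empiricalMeasure ((Φ N).flow (s * ((N : ℝ) + 1) ^ (-(1 / 3 : ℝ))) z))) ^ 2)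
              ∂(localGibbsLaw σ (fun _ => 1) (fun _ => 0) (fun _ => θ) N (Φ N))
              ≤ ENNReal.ofReal (δ / ((N : ℝ) + 1))) →
          ∀ δ : ℝ, 0 < δ → ∃ S₀ : ℝ, 0 < S₀ ∧ ∀ S : ℝ, S₀ ≤ S → ∃ N₀ : ℕ, ∀ N : ℕ, N₀ ≤ N →
            |S⁻¹ * ∫ s in (0 : ℝ)..S, ((N : ℝ) + 1) * ∫ z,
                (∫ y, χ y.1 * h y.2
                    ∂(empiricalMeasure ((Φ N).flow (s * ((N : ℝ) + 1) ^ (-(1 / 3 : ℝ))) z))) *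
                  (∫ y, χ y.1 * h y.2 ∂(empiricalMeasure z))
                ∂(localGibbsLaw σ (fun _ => 1) (fun _ => 0) (fun _ => θ) N (Φ N))| ≤ δ := by
  intro σ hσ hσ2 θ hθ h hh hpoly h1 Φ χ hχ hW δ hδ
  -- the static constant `M = (∫ χ²)(∫ h² M_θ)` and the tolerance `δ' = δ²/(|M|+1)`
  set M : ℝ := (∫ x, χ x * χ x) * ∫ v, h v ^ 2 * localMaxwellian 1 θ (0 : V3) v with hM
  have hM1 : 0 < |M| + 1 := by positivity
  obtain ⟨T₀, hT₀, hT⟩ := hW (δ ^ 2 / (|M| + 1)) (by positivity)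
  refine ⟨T₀, hT₀, fun S hS => ?_⟩
  have hS0 : 0 < S := lt_of_lt_of_le hT₀ hS
  obtain ⟨N₀, hN⟩ := hT S hS
  refine ⟨N₀, fun N hNN => ?_⟩
  have hlin := hN N hNN
  obtain ⟨C, k, hCk⟩ := hpoly
  haveI : IsProbabilityMeasure (localGibbsLaw σ (fun _ => 1) (fun _ => 0) (fun _ => θ) N (Φ N)) :=
    isProbabilityMeasure_localGibbsLaw_const hθ hσ2.le (0 : V3) N (Φ N)
  have hAm : Measurable fun z : Config (N + 1) (Fin 3) T3 =>
      ∫ y, χ y.1 * h y.2 ∂(empiricalMeasure z) := measurable_oneBodyField hχ hh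
  have hA2 := memLp_two_oneBodyField_localGibbsLaw_one hθ hσ2.le N (Φ N) hχ hh hCk
  have hgood : localGibbsLaw σ (fun _ => 1) (fun _ => 0) (fun _ => θ) N (Φ N) (Φ N).goodᶜ = 0 :=
    mem_ae_iff.1 (ae_mem_good_localGibbsLaw σ (fun _ => 1) (fun _ => 0) (fun _ => θ) N (Φ N))
  have hinv : ∀ t, MeasurePreserving ((Φ N).flow t)
      (localGibbsLaw σ (fun _ => 1) (fun _ => 0) (fun _ => θ) N (Φ N))
      (localGibbsLaw σ (fun _ => 1) (fun _ => 0) (fun _ => θ) N (Φ N)) :=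
    fun t => measurePreserving_flow_localGibbsLaw_const σ 1 θ 0 N (Φ N) t
  have hNpos : (0 : ℝ) < (N : ℝ) + 1 := by positivity
  -- statics: `(N+1) E_G[A²] = M`
  have hstat : ((N : ℝ) + 1) * ∫ z, (∫ y, χ y.1 * h y.2 ∂(empiricalMeasure z)) ^ 2
      ∂(localGibbsLaw σ (fun _ => 1) (fun _ => 0) (fun _ => θ) N (Φ N)) = M := by
    rw [hM, ← torusStaticVariance σ hσ hσ2 θ hθ h hh ⟨C, k, hCk⟩ h1 N (Φ N) χ hχ]
    congr 1
    refine integral_congr_ae ?_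
    filter_upwards [ae_mem_good_localGibbsLaw σ (fun _ => 1) (fun _ => 0) (fun _ => θ) N (Φ N)]
      with z hz
    rw [(Φ N).flow_zero z hz, sq]
  exact abs_cesaro_le (Φ N) _ hinv hgood hAm hA2 _ hNpos hδ hS0 hstat hlin

end Summit.AtomisticToContinuum.HydrodynamicLimit.Theorems.MourreKoopmanChargesOneBodyCompleteness

end
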